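import Summits.PneNP.PneNP.Theorems.SymmetryBudgetWindowBarrierEntropyGame

/-!
# The canonical entropy game: coset refinement
(dichotomy `WindowBarrier` stmt-PneNP-2145 / `NoHiddenOrder` stmt-PneNP-14781, route `PneNP/SymmetryBudget`)

`SymmetryBudgetWindowBarrierEntropyGame.lean` defines Duplicator's condition `CosetGame.EntropyGame K G H`
as DATA (two relation families closed under the moves).  This file computes the COARSEST such data —
the analogue of the stable colouring of Weisfeiler–Leman refinement, here on cosets of the block
groups — and proves that an entropy game exists iff the canonical refinement never separates the
one-block positions:

* `CosetGame.IsType K A` — `A = blockGroup μ` for some labelling `μ` of entropy `≤ K n`.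
* `CosetGame.Rel K r A G β H γ` — round-`r` equivalence of the position `β` (type `A`) of `G` with
  the position `γ` of `H`, by recursion on `r`: always at round `0`; at round `r + 1` iff at round `r`
  and, for every type `B`, some bijection `e` of `A` has `(β ρ, γ (e ρ))` round-`r` equivalent at
  type `B` for all `ρ ∈ A`, and, for every input pair `q`, some bijection `e` of `A` matches the
  adjacency bits read at `q` through `β ρ` and `γ (e ρ)`.
* It is antitone in `r` (`Rel.of_succ`, `Rel.anti`), reflexive, symmetric, transitive
  (`Rel.refl/symm/trans`), and invariant under the right action of `A` on either position
  (`Rel.mul_mem_left/right`: it lives on COSETS `β A`, `γ A`).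
* `CosetGame.RelInf K A G β H γ := ∀ r, Rel K r A G β H γ`.
* **`CosetGame.entropyGame_of_relInf`**: if some pair of one-block positions is `RelInf`-related
  then `EntropyGame K G H` (relations := `RelInf`; the bijection for all rounds at once comes from
  the pigeonhole principle on the finite set of bijections of `blockGroup μ`).
* **`CosetGame.relInf_of_entropyGame`**: every entropy game is contained in the canonical one; hence
  **`CosetGame.nonempty_entropyGame_iff`**:
  `Nonempty (EntropyGame K G H) ↔ ∃ β γ, RelInf K (blockGroup fun _ => 0) G β H γ`.

This is the invariant a completeness theorem has to compile into symmetric circuits (gates indexed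
by rounds, types and cosets); nothing about circuits is in this file.
-/

-- `Summit.PneNP.PneNP.…` duplicates `PneNP` BY DESIGN (single-problem summit).
set_option linter.dupNamespace false

namespace Summit.PneNP.PneNP.Theorems

open Finset Literature.Computability.Complexity

namespace CosetGame

variable {n : ℕ}

/-- The TYPES of the entropy-`K` game on `n` points: the block groups of the labellings of entropy
`≤ K n`. -/
def IsType (K : ℕ) (A : Subgroup (Equiv.Perm (Fin n))) : Prop :=
  ∃ μ : Fin n → ℕ, IsLowEntropy K μ ∧ blockGroup μ = A

/-- Block groups of low-entropy labellings are types. -/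
theorem isType_blockGroup {K : ℕ} {μ : Fin n → ℕ} (h : IsLowEntropy K μ) : IsType K (blockGroup μ) :=
  ⟨μ, h, rfl⟩

/-- **Canonical coset refinement.**  `Rel K r A G β H γ`: the position `β` of type `A` of `G` and the
position `γ` of type `A` of `H` are not separated in `r` rounds of the entropy-`K` game. -/
def Rel (K : ℕ) : ℕ → Subgroup (Equiv.Perm (Fin n)) → SimpleGraph (Fin n) → Equiv.Perm (Fin n) →
    SimpleGraph (Fin n) → Equiv.Perm (Fin n) → Prop
  | 0, _, _, _, _, _ => True
  | r + 1, A, G, β, H, γ => Rel K r A G β H γ ∧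
      (∀ B : Subgroup (Equiv.Perm (Fin n)), IsType K B →
        ∃ e : A ≃ A, ∀ ρ : A, Rel K r B G (β * ρ) H (γ * e ρ)) ∧
      (∀ q : Fin n × Fin n, ∃ e : A ≃ A, ∀ ρ : A,
        (G.Adj ((β * ρ) q.1) ((β * ρ) q.2) ↔ H.Adj ((γ * e ρ) q.1) ((γ * e ρ) q.2)))

/-- The limit of the refinement. -/
def RelInf (K : ℕ) (A : Subgroup (Equiv.Perm (Fin n))) (G : SimpleGraph (Fin n)) (β : Equiv.Perm (Fin n))
    (H : SimpleGraph (Fin n)) (γ : Equiv.Perm (Fin n)) : Prop :=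
  ∀ r : ℕ, Rel K r A G β H γ

namespace Rel

variable {K : ℕ}

/-- Round `0` relates everything. -/
@[simp] theorem zero (A : Subgroup (Equiv.Perm (Fin n))) (G : SimpleGraph (Fin n)) (β : Equiv.Perm (Fin n))
    (H : SimpleGraph (Fin n)) (γ : Equiv.Perm (Fin n)) : Rel K 0 A G β H γ := trivial

/-- Unfolding of a successor round. -/
theorem succ_iff (r : ℕ) (A : Subgroup (Equiv.Perm (Fin n))) (G : SimpleGraph (Fin n))
    (β : Equiv.Perm (Fin n)) (H : SimpleGraph (Fin n)) (γ : Equiv.Perm (Fin n)) :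
    Rel K (r + 1) A G β H γ ↔ Rel K r A G β H γ ∧
      (∀ B : Subgroup (Equiv.Perm (Fin n)), IsType K B →
        ∃ e : A ≃ A, ∀ ρ : A, Rel K r B G (β * ρ) H (γ * e ρ)) ∧
      (∀ q : Fin n × Fin n, ∃ e : A ≃ A, ∀ ρ : A,
        (G.Adj ((β * ρ) q.1) ((β * ρ) q.2) ↔ H.Adj ((γ * e ρ) q.1) ((γ * e ρ) q.2))) :=
  Iff.rfl

/-- One round less. -/
theorem of_succ {r : ℕ} {A : Subgroup (Equiv.Perm (Fin n))} {G : SimpleGraph (Fin n)}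
    {β : Equiv.Perm (Fin n)} {H : SimpleGraph (Fin n)} {γ : Equiv.Perm (Fin n)}
    (h : Rel K (r + 1) A G β H γ) : Rel K r A G β H γ := h.1

/-- **Antitone in the number of rounds.** -/
theorem anti {r r' : ℕ} (hr : r ≤ r') {A : Subgroup (Equiv.Perm (Fin n))} {G : SimpleGraph (Fin n)}
    {β : Equiv.Perm (Fin n)} {H : SimpleGraph (Fin n)} {γ : Equiv.Perm (Fin n)}
    (h : Rel K r' A G β H γ) : Rel K r A G β H γ := by
  induction hr with
  | refl => exact h
  | step _ ih => exact ih h.1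

/-- **Reflexivity.** -/
theorem refl (r : ℕ) : ∀ (A : Subgroup (Equiv.Perm (Fin n))) (G : SimpleGraph (Fin n))
    (β : Equiv.Perm (Fin n)), Rel K r A G β G β := by
  induction r with
  | zero => intro A G β; trivial
  | succ r ih =>
    intro A G β
    refine ⟨ih A G β, fun B _ => ⟨Equiv.refl _, fun ρ => ih B G _⟩, fun q => ⟨Equiv.refl _, fun ρ => Iff.rfl⟩⟩

/-- **Symmetry.** -/
theorem symm (r : ℕ) : ∀ {A : Subgroup (Equiv.Perm (Fin n))} {G : SimpleGraph (Fin n)}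
    {β : Equiv.Perm (Fin n)} {H : SimpleGraph (Fin n)} {γ : Equiv.Perm (Fin n)},
    Rel K r A G β H γ → Rel K r A H γ G β := by
  induction r with
  | zero => intros; trivial
  | succ r ih =>
    rintro A G β H γ ⟨h0, hB, hq⟩
    refine ⟨ih h0, fun B hBt => ?_, fun q => ?_⟩
    · obtain ⟨e, he⟩ := hB B hBt
      refine ⟨e.symm, fun ρ => ?_⟩
      have h := he (e.symm ρ)
      rw [Equiv.apply_symm_apply] at h
      exact ih h
    · obtain ⟨e, he⟩ := hq q
      refine ⟨e.symm, fun ρ => ?_⟩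
      have h := he (e.symm ρ)
      rw [Equiv.apply_symm_apply] at h
      exact h.symm

/-- **Transitivity.** -/
theorem trans (r : ℕ) : ∀ {A : Subgroup (Equiv.Perm (Fin n))} {G₁ : SimpleGraph (Fin n)}
    {β₁ : Equiv.Perm (Fin n)} {G₂ : SimpleGraph (Fin n)} {β₂ : Equiv.Perm (Fin n)}
    {G₃ : SimpleGraph (Fin n)} {β₃ : Equiv.Perm (Fin n)},
    Rel K r A G₁ β₁ G₂ β₂ → Rel K r A G₂ β₂ G₃ β₃ → Rel K r A G₁ β₁ G₃ β₃ := by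
  induction r with
  | zero => intros; trivial
  | succ r ih =>
    rintro A G₁ β₁ G₂ β₂ G₃ β₃ ⟨h0, hB, hq⟩ ⟨h0', hB', hq'⟩
    refine ⟨ih h0 h0', fun B hBt => ?_, fun q => ?_⟩
    · obtain ⟨e, he⟩ := hB B hBt
      obtain ⟨e', he'⟩ := hB' B hBt
      exact ⟨e.trans e', fun ρ => ih (he ρ) (by simpa only [Equiv.trans_apply] using he' (e ρ))⟩
    · obtain ⟨e, he⟩ := hq q
      obtain ⟨e', he'⟩ := hq' q
      exact ⟨e.trans e', fun ρ => (he ρ).trans (by simpa only [Equiv.trans_apply] using he' (e ρ))⟩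

/-- Left multiplication by a group element, as a bijection of the group. -/
def mulLeftEquiv {A : Subgroup (Equiv.Perm (Fin n))} (a : A) : A ≃ A where
  toFun ρ := a * ρ
  invFun ρ := a⁻¹ * ρ
  left_inv ρ := by simp
  right_inv ρ := by simp

/-- `mulLeftEquiv a` is left multiplication by `a`. -/
@[simp] theorem mulLeftEquiv_apply {A : Subgroup (Equiv.Perm (Fin n))} (a ρ : A) :
    mulLeftEquiv a ρ = a * ρ := rfl

/-- **Invariance under the type group on the first position**: `Rel` only depends on the coset
`β A`. -/
theorem mul_mem_left (r : ℕ) : ∀ {A : Subgroup (Equiv.Perm (Fin n))} {G : SimpleGraph (Fin n)}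
    {β : Equiv.Perm (Fin n)} {H : SimpleGraph (Fin n)} {γ : Equiv.Perm (Fin n)} {a : Equiv.Perm (Fin n)},
    a ∈ A → (Rel K r A G (β * a) H γ ↔ Rel K r A G β H γ) := by
  induction r with
  | zero => intros; exact Iff.rfl
  | succ r ih =>
    intro A G β H γ a ha
    -- one direction suffices, applied to `a` and to `a⁻¹`
    have key : ∀ (β : Equiv.Perm (Fin n)) (a : Equiv.Perm (Fin n)), a ∈ A →
        Rel K (r + 1) A G (β * a) H γ → Rel K (r + 1) A G β H γ := by
      rintro β a ha ⟨h0, hB, hq⟩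
      refine ⟨(ih ha).1 h0, fun B hBt => ?_, fun q => ?_⟩
      · obtain ⟨e, he⟩ := hB B hBt
        refine ⟨(mulLeftEquiv (⟨a, ha⟩⁻¹ : A)).trans e, fun ρ => ?_⟩
        have h := he (⟨a, ha⟩⁻¹ * ρ)
        have hprod : β * a * ((⟨a, ha⟩⁻¹ * ρ : A) : Equiv.Perm (Fin n)) = β * ρ := by
          simp [mul_assoc]
        rw [hprod] at h
        exact h
      · obtain ⟨e, he⟩ := hq q
        refine ⟨(mulLeftEquiv (⟨a, ha⟩⁻¹ : A)).trans e, fun ρ => ?_⟩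
        have h := he (⟨a, ha⟩⁻¹ * ρ)
        have hprod : β * a * ((⟨a, ha⟩⁻¹ * ρ : A) : Equiv.Perm (Fin n)) = β * ρ := by
          simp [mul_assoc]
        rw [hprod] at h
        exact h
    refine ⟨key β a ha, fun h => key (β * a) a⁻¹ (A.inv_mem ha) ?_⟩
    rwa [mul_assoc, mul_inv_cancel, mul_one]

/-- **Invariance under the type group on the second position**: `Rel` only depends on the coset
`γ A`. -/
theorem mul_mem_right (r : ℕ) {A : Subgroup (Equiv.Perm (Fin n))} {G : SimpleGraph (Fin n)}
    {β : Equiv.Perm (Fin n)} {H : SimpleGraph (Fin n)} {γ : Equiv.Perm (Fin n)} {a : Equiv.Perm (Fin n)}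
    (ha : a ∈ A) : Rel K r A G β H (γ * a) ↔ Rel K r A G β H γ :=
  ⟨fun h => symm r ((mul_mem_left r ha).1 (symm r h)), fun h => symm r ((mul_mem_left r ha).2 (symm r h))⟩

end Rel

/-! ### The canonical game -/

/-- **Every entropy game is contained in the canonical refinement.** -/
theorem rel_of_entropyGame {K : ℕ} {G H : SimpleGraph (Fin n)} (g : EntropyGame K G H) (r : ℕ) :
    ∀ (μ : Fin n → ℕ), IsLowEntropy K μ → ∀ (β β' : Equiv.Perm (Fin n)), g.R μ β β' →
      Rel K r (blockGroup μ) G β H β' := by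
  induction r with
  | zero => intros; trivial
  | succ r ih =>
    intro μ hμ β β' hR
    refine ⟨ih μ hμ β β' hR, ?_, fun q => ?_⟩
    · rintro B ⟨ν, hν, rfl⟩
      obtain ⟨e, he⟩ := g.stepR μ ν hμ hν β β' hR
      exact ⟨e, fun ρ => ih ν hν _ _ (he ρ)⟩
    · obtain ⟨e, he⟩ := g.stepP μ q hμ β β' hR
      exact ⟨e, fun ρ => g.adj q _ _ (he ρ)⟩

/-- Hence an entropy game makes some pair of one-block positions `RelInf`-related. -/
theorem relInf_of_entropyGame {K : ℕ} {G H : SimpleGraph (Fin n)} (g : EntropyGame K G H) :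
    ∃ β γ : Equiv.Perm (Fin n), RelInf K (blockGroup fun _ : Fin n => 0) G β H γ := by
  obtain ⟨β, β', h⟩ := g.init
  exact ⟨β, β', fun r => rel_of_entropyGame g r _ (isLowEntropy_const K) β β' h⟩

/-- **Pigeonhole for the limit**: if at every round some bijection of the finite group `A` works for
an antitone family of requirements, one bijection works at every round. -/
theorem exists_equiv_forall {A : Subgroup (Equiv.Perm (Fin n))} (P : ℕ → A → A → Prop)
    (hanti : ∀ r ρ ρ', P (r + 1) ρ ρ' → P r ρ ρ')
    (h : ∀ r, ∃ e : A ≃ A, ∀ ρ, P r ρ (e ρ)) : ∃ e : A ≃ A, ∀ r ρ, P r ρ (e ρ) := by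
  classical
  by_contra hne
  push Not at hne
  choose r hr using hne
  -- antitone in the round, for any gap
  have hanti' : ∀ {r r'} (_ : r ≤ r') ρ ρ', P r' ρ ρ' → P r ρ ρ' := by
    intro r r' hrr' ρ ρ'
    induction hrr' with
    | refl => exact id
    | step _ ih => exact fun h => ih (hanti _ _ _ h)
  obtain ⟨e, he⟩ := h (Finset.univ.sup r)
  obtain ⟨ρ, hρ⟩ := hr e
  exact hρ (hanti' (Finset.le_sup (Finset.mem_univ e)) ρ (e ρ) (he ρ))

/-- **The canonical refinement is an entropy game**: if some one-block positions are
`RelInf`-related then `EntropyGame K G H`, with relations `R μ := RelInf K (blockGroup μ)` and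
`P q β β' := (G.Adj (β q.1) (β q.2) ↔ H.Adj (β' q.1) (β' q.2))`. -/
noncomputable def entropyGame_of_relInf {K : ℕ} {G H : SimpleGraph (Fin n)}
    (h : ∃ β γ : Equiv.Perm (Fin n), RelInf K (blockGroup fun _ : Fin n => 0) G β H γ) :
    EntropyGame K G H where
  R μ β β' := RelInf K (blockGroup μ) G β H β'
  P q β β' := G.Adj (β q.1) (β q.2) ↔ H.Adj (β' q.1) (β' q.2)
  adj _ _ _ h := h
  init := h
  stepR μ ν _ hν β β' hR := by
    have hstep : ∀ r, ∃ e : blockGroup μ ≃ blockGroup μ, ∀ ρ : blockGroup μ,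
        Rel K r (blockGroup ν) G (β * ρ) H (β' * e ρ) := fun r =>
      (hR (r + 1)).2.1 (blockGroup ν) (isType_blockGroup hν)
    obtain ⟨e, he⟩ := exists_equiv_forall
      (fun r (ρ ρ' : blockGroup μ) => Rel K r (blockGroup ν) G (β * ρ) H (β' * ρ'))
      (fun r ρ ρ' h => h.1) hstep
    exact ⟨e, fun ρ r => he r ρ⟩
  stepP μ q _ β β' hR := (hR 1).2.2 q

/-- **Characterisation**: an entropy-`K` game between `G` and `H` exists iff the canonical coset
refinement relates some pair of one-block positions at every round. -/
theorem nonempty_entropyGame_iff (K : ℕ) (G H : SimpleGraph (Fin n)) :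
    Nonempty (EntropyGame K G H) ↔
      ∃ β γ : Equiv.Perm (Fin n), RelInf K (blockGroup fun _ : Fin n => 0) G β H γ :=
  ⟨fun ⟨g⟩ => relInf_of_entropyGame g, fun h => ⟨entropyGame_of_relInf h⟩⟩

end CosetGame

end Summit.PneNP.PneNP.Theorems
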